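import Summits.ABC.IUTFork.Cor312TwoPlacePins
import Summits.ABC.IUTFork.Repair.CandLana1
import Summits.ABC.IUTFork.Repair.CandMochizuki6
import HarnessLib

/-!
# IUT REPAIR branch (rung LADDER-ABC:A2.RP) — the «2P» COLUMN, part 4 (seat abc-iut-rp-m4): the STRICT profile `d = (0, 4)` separates the
# GLOBAL EQUALITY supplier RP-L01 from the GLOBAL INEQUALITY suppliers

Record file of the abc-iut cell's REPAIR branch (seat abc-iut-rp-m4; lead abc-iut-rp-plan). TAKES NO SIDE on [IUTchIII] Cor. 3.12 or on any
author; PROOF-ONLY; the hypotheses evaluated are typed CANDIDATES of their record files (`Repair/CandLana1` p434743, `Repair/CandMochizuki6`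
p428116), never asserted. `TwoPlaceProfile2` (p436352) found RP-L01 (`CandLana1.H`: «SOME global possible image of the Θ-pilot has
procession-normalised log-volume EQUAL to −|log(q)|») TRUE at the two-place bed of record `depth = (0, 3)` — where `−|log(Θ)| = −2c = −|log(q)|`
holds with EQUALITY. THIS FILE runs the bed at the STRICT inflation profile `depth4 = (0, 4)` (total inflation `4 > 3`): the typed Statement
still HOLDS (`3 ≤ 0 + 4`, now strictly: `−2c < −c`), the GLOBAL INEQUALITY row RP-M36d (`CandMochizuki6.H'''`) still HOLDS, but RP-L01 FAILS
(`−|log(Θ)| = −c ≠ −2c`): the equality-type global volume supplier is STRICTLY STRONGER than the Statement and its ✓ at `(0, 3)` is the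
equality coincidence — a cell for the L01 word («VOLUME-class, '=' form»). The Licence, `GapH3` and the residual S fail at `(0, 4)` as at
`(0, 3)` (deep place `0` unchanged). Standard axioms only. [claim: Mochizuki2012, status: disputed]
-/

noncomputable section

open Set

namespace Summit.ABC.IUTFork.Repair.TwoPlaceProfile4

open Thm311 Cor312 Cor312Vol Cor312Vol.TwoPlace Cor312Vol.NaiveProv Literature.IUT.LogThetaLattice

variable (p : ℕ) [hp : Fact p.Prime] (c : ℝ)

/-- The STRICT inflation profile: none at the place `0`, exponent `4` at the place `1`. MODEL DATA (a function). [folklore] -/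
def depth4 : twoIndex.VQ → ℕ := fun vQ => 4 * (vQ : ℕ)

omit hp in
/-- `depth4 0 = 0`, `depth4 1 = 4`. [folklore] -/
theorem depth4_val : depth4 0 = 0 ∧ depth4 1 = 4 := by decide

/-- The typed Statement HOLDS at the strict profile (`3 ≤ 0 + 4`). [folklore] -/
theorem statement_depth4 (hc : 0 < c) : Summit.ABC.IUTFork.Cor312.Setting.Statement (twoSetting p c depth4) :=
  (two_statement_iff p c depth4 hc).2 (by rw [depth4_val.1, depth4_val.2]; decide)

/-- … STRICTLY: `−|log(Θ)| = −c > −2c = −|log(q)|`. [folklore] -/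
theorem negLogTheta_depth4 : (twoSetting p c depth4).negLogTheta = ((-c : ℝ) : WithTop ℝ) ∧ (twoSetting p c depth4).negLogQ = -2 * c := by
  refine ⟨?_, two_negLogQ p c depth4⟩
  rw [two_negLogTheta, depth4_val.1, depth4_val.2]
  exact WithTop.coe_inj.2 (by push_cast; ring)

/-- The (xi-f) Licence FAILS at the strict profile too (deep place `0`: `B_1 ⊄ B_4`). [folklore] -/
theorem not_licence_depth4 : ¬ Thm311ToCor312.Licence (twoSetting p c depth4) := fun h => by
  have h0 := (two_licenceAt_iff p c depth4 0).1 fun i => h i 0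
  rw [depth4_val.1] at h0
  exact absurd h0 (by decide)

/-- … hence the residual S FAILS for the pinned reading at the strict profile. [folklore] -/
theorem not_S_depth4 :
    ¬ PilotKummerIndRelated (twoFull p c).toLatticeSituation (twoSetting p c depth4) (rho2 p depth4) (qDatum p (0 : twoIndex.V) trivial c) :=
  fun hS => not_licence_depth4 p c (Thm311ToCor312.licence_of_qRegion_mem_possibleImages _ fun i vQ =>
    (reading3_iff_pilotKummerIndRelated (twoFull p c).toLatticeSituation (twoSetting p c depth4) _ _ (two_kummerB p c _)
      (two_pinnedRegions3 p c depth4).1).2 hS (Setting.labelSucc i) vQ)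

/-- ✗ **RP-L01 at the strict profile**: `CandLana1.H` FAILS at `depth4 = (0, 4)` for every region reading (`−|log(Θ)| = −c ≠ −2c = −|log(q)|`;
`c > 0`) — although the typed Statement holds there. [folklore] -/
theorem L01_fails_depth4 (hc : 0 < c)
    (ρ : (∀ v : twoIndex.V, v ∈ twoIndex.Vbad → Set ((signShells twoIndex).StarPacket v)) →
      ∀ (j : twoIndex.Label) (vQ : twoIndex.VQ), Set ((signShells twoIndex).Packet j vQ))
    (qK : ∀ v : twoIndex.V, v ∈ twoIndex.Vbad → Set ((signShells twoIndex).StarPacket v)) :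
    ¬ CandLana1.H (twoFull p c).toLatticeSituation (twoSetting p c depth4) ρ qK := by
  intro h
  have hV : ∀ (i : Fin twoIndex.lstar) (vQ : twoIndex.VQ), (twoSetting p c depth4).possibleImages (Setting.labelSucc i) vQ =
      {(twoSetting p c depth4).thetaHull (Setting.labelSucc i) vQ} := fun i vQ => by
    rw [two_possibleImages, (two_thetaHull p c depth4 _ vQ).1]
  have h1 := (CandLana1.H_iff_negLogTheta_eq (twoFull p c).toLatticeSituation (twoSetting p c depth4) ρ qK
    (two_bridgeHyps p c depth4 hc.le) hV).1 h
  rw [(negLogTheta_depth4 p c).1, (negLogTheta_depth4 p c).2] at h1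
  have h2 : (-c : ℝ) = -2 * c := by exact_mod_cast h1
  linarith

/-- ✓ **RP-M36d at the strict profile**: the GLOBAL INEQUALITY row `CandMochizuki6.H'''` (`−|log(q)| ≤ −|log(Θ)|`) HOLDS at `(0, 4)`. [folklore] -/
theorem M36d_holds_depth4 (hc : 0 < c) : CandMochizuki6.H''' (twoFull p c).toLatticeSituation (twoSetting p c depth4) :=
  (CandMochizuki6.H'''_iff_statement _ _ (two_thetaFinite p c depth4)).2 (statement_depth4 p c hc)

/-- **THE STRICT-PROFILE SEPARATION (`c = log p`)**: at the pinned two-place bed with inflation `(0, 4)` the three pins and the typed Statement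
hold, the Licence and the residual S fail, the global INEQUALITY row M36d holds and the global EQUALITY row L01 fails — L01 is strictly
stronger than the Statement; its ✓ at `(0, 3)` (`TwoPlaceProfile2.L01_holds`) is the equality case. [folklore] -/
theorem strict_profile_separates :
    PinnedRegions3 (twoFull p (Real.log p)).toLatticeSituation (twoSetting p (Real.log p) depth4) (rho2 p depth4)
        (qDatum p (0 : twoIndex.V) trivial (Real.log p)) ∧
      Summit.ABC.IUTFork.Cor312.Setting.Statement (twoSetting p (Real.log p) depth4) ∧
      ¬ Thm311ToCor312.Licence (twoSetting p (Real.log p) depth4) ∧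
      ¬ PilotKummerIndRelated (twoFull p (Real.log p)).toLatticeSituation (twoSetting p (Real.log p) depth4) (rho2 p depth4)
        (qDatum p (0 : twoIndex.V) trivial (Real.log p)) ∧
      CandMochizuki6.H''' (twoFull p (Real.log p)).toLatticeSituation (twoSetting p (Real.log p) depth4) ∧
      ¬ CandLana1.H (twoFull p (Real.log p)).toLatticeSituation (twoSetting p (Real.log p) depth4) (rho2 p depth4)
        (qDatum p (0 : twoIndex.V) trivial (Real.log p)) :=
  have hc : 0 < Real.log p := Real.log_pos (by exact_mod_cast hp.out.one_lt)
  ⟨two_pinnedRegions3 p _ depth4, statement_depth4 p _ hc, not_licence_depth4 p _, not_S_depth4 p _, M36d_holds_depth4 p _ hc,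
    L01_fails_depth4 p _ hc _ _⟩

end Summit.ABC.IUTFork.Repair.TwoPlaceProfile4

end
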